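import Summits.CriticalPhenomena.Ising3DConformalLimit.Theorems.PerfectScreeningGaussianLimitIsCoulombCore
import HarnessLib

/-!
# `PerfectScreening.GaussianLimitIsCoulomb` (item stmt-CriticalPhenomena-1343) is the exact complement
# of the crux r3 `CoulombImpliesNontrivial` inside crux 0636 — no screening dichotomy needed

THEOREM-ONLY file (no definitions, no named facts), `--supports stmt-CriticalPhenomena-1343`, fifth of
the series after `…Reductions.lean`, `…Renormalisation.lean`, `…Discharge.lean`, `…Core.lean`.

Write `Coulomb := ∃ c > 0, ∀ x ≠ 0, c/‖x‖ ≤ ⟨σ₀σ_x⟩_{β_c(3)}` (the conclusion of item 1343 and the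
antecedent of crux r3 = `CoulombImpliesNontrivial`, item stmt-CriticalPhenomena-13885) and
`0636 := IsingEuclidUpgradeR4NonGaussian` (every non-degenerate pointwise scaling limit of
`criticalCorr 3` has `U₄ ≢ 0`; crux of route IsingEuclidUpgrade). Then

* r3 is `Coulomb → 0636` by `Iff.rfl` (the two route decls are syntactically the same `∀ ρ S, …`);
* `gaussianLimitIsCoulomb_iff_not_coulomb_imp_r4NonGaussian` — item 1343 is `¬Coulomb → 0636`
  (its Möbius/`Δ` binders being idle, `gaussianLimitIsCoulomb_iff_core` of `…Core.lean` §2);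

so the two PerfectScreening items are the two halves of a case split of crux 0636 along `Coulomb`:

* `r4NonGaussian_iff_coulombImpliesNontrivial_and_gaussianLimitIsCoulomb` — **`0636 ↔ r3 ∧ 1343`,
  unconditionally.** Compare `…Core.lean` §6 (`coulombImpliesNontrivial_and_notScreened_iff_r4NonGaussian`):
  with the WEAK crux r4 = `GaussianLimitNotScreened` (13886) in place of 1343 the same equivalence needs the
  screening dichotomy, i.e. `SubharmonicOffOrigin` (1341) or `EventuallySubharmonic` (13887). This is the
  precise sense in which rev 4 of the route traded the strong support item 1343 for `SubH + r4`.
* `gaussianLimitIsCoulomb_iff_coulombImpliesNontrivial_imp_r4NonGaussian` — `1343 ↔ (r3 → 0636)`: the item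
  says exactly "if the Coulomb crux r3 is proved, non-triviality of every non-degenerate pointwise limit
  follows"; symmetrically `coulombImpliesNontrivial_iff_gaussianLimitIsCoulomb_imp_r4NonGaussian` —
  `r3 ↔ (1343 → 0636)`.
* `gaussianLimitIsCoulomb_or_coulombImpliesNontrivial` — `1343 ∨ r3` holds outright (excluded middle on
  `Coulomb`): at most one of the two items can be false, and refuting either one PROVES the other.

Consequence recorded for the planner: item 1343 carries no content independent of crux 0636 and crux
r3 — it is literally `0636` restricted to the non-Coulomb regime `¬Coulomb` (= `NonSaturation`,
`…Renormalisation.lean` `not_coulomb_iff_nonSaturation`, the physical regime `η(3) > 0`), where it is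
the open non-triviality problem of the critical Ising model on `ℤ³`.

References: M. Aizenman, Comm. Math. Phys. 86 (1982) 1–48 (non-triviality via intersecting currents,
`d = 2`; the `d = 3` case open); M. Aizenman, H. Duminil-Copin, Ann. Math. 194 (2021) (`d = 4`);
H. Duminil-Copin, ICM 2022 §6.4, §8.4 (status of `d = 3`).
-/

namespace Summit.CriticalPhenomena.Ising3DConformalLimit.PerfectScreeningGaussianLimitIsCoulomb

open Literature.Probability.LatticeModels Filter Set
open Summit.CriticalPhenomena.Ising3DConformalLimit.Theses

/-- **Item 1343 = (`¬Coulomb` ⇒ crux 0636).** `GaussianLimitIsCoulomb` holds iff the FAILURE of the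
lattice Coulomb lower bound `∃ c > 0, ∀ x ≠ 0, c/‖x‖ ≤ ⟨σ₀σ_x⟩_{β_c}` implies
`IsingEuclidUpgradeR4NonGaussian` (every non-degenerate pointwise scaling limit of `criticalCorr 3` has
`U₄ ≢ 0`). Pure logic on the symmetry-free core of the item (`gaussianLimitIsCoulomb_iff_core`: the
binder `Δ` and the clause `IsMoebiusCovariant Δ S` are idle). [folklore] -/
theorem gaussianLimitIsCoulomb_iff_not_coulomb_imp_r4NonGaussian :
    PerfectScreening.GaussianLimitIsCoulomb ↔
      ((¬ ∃ c : ℝ, 0 < c ∧ ∀ x : Site 3, x ≠ 0 → c / ‖x‖ ≤ criticalTwoPoint 3 x) →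
        IsingEuclidUpgrade.IsingEuclidUpgradeR4NonGaussian) := by
  rw [gaussianLimitIsCoulomb_iff_core]
  constructor
  · intro h hC ρ S hρ hlim hnd
    by_contra hU4
    exact hC (h ρ S hρ hlim hnd fun z hz => by_contra fun hne => hU4 ⟨z, hz, hne⟩)
  · intro h ρ S hρ hlim hnd hU
    by_contra hC
    obtain ⟨z, hz, hne⟩ := h hC ρ S hρ hlim hnd
    exact hne (hU z hz)

/-- **Crux 0636 ↔ r3 ∧ item 1343, unconditionally.** `IsingEuclidUpgradeR4NonGaussian` (every
non-degenerate pointwise scaling limit of the critical `ℤ³` correlators interacts) is EQUIVALENT to the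
conjunction of the crux `CoulombImpliesNontrivial` (r3, item 13885: `Coulomb → 0636`, definitionally) and
the support item `GaussianLimitIsCoulomb` (1343: `¬Coulomb → 0636`). No screening dichotomy, no `SubH`:
the case split is excluded middle on the Coulomb lower bound. [folklore] -/
theorem r4NonGaussian_iff_coulombImpliesNontrivial_and_gaussianLimitIsCoulomb :
    IsingEuclidUpgrade.IsingEuclidUpgradeR4NonGaussian ↔
      (PerfectScreening.CoulombImpliesNontrivial ∧ PerfectScreening.GaussianLimitIsCoulomb) := by
  rw [gaussianLimitIsCoulomb_iff_not_coulomb_imp_r4NonGaussian]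
  constructor
  · exact fun h => ⟨fun _ => h, fun _ => h⟩
  · rintro ⟨h3, h1343⟩
    by_cases hC : ∃ c : ℝ, 0 < c ∧ ∀ x : Site 3, x ≠ 0 → c / ‖x‖ ≤ criticalTwoPoint 3 x
    · exact h3 hC
    · exact h1343 hC

/-- **Item 1343 ↔ (r3 ⇒ 0636).** `GaussianLimitIsCoulomb` says exactly: a proof of the Coulomb crux
`CoulombImpliesNontrivial` would already give non-triviality of EVERY non-degenerate pointwise scaling
limit of `criticalCorr 3` (`IsingEuclidUpgradeR4NonGaussian`). [folklore] -/
theorem gaussianLimitIsCoulomb_iff_coulombImpliesNontrivial_imp_r4NonGaussian :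
    PerfectScreening.GaussianLimitIsCoulomb ↔
      (PerfectScreening.CoulombImpliesNontrivial → IsingEuclidUpgrade.IsingEuclidUpgradeR4NonGaussian) := by
  constructor
  · exact fun h h3 =>
      r4NonGaussian_iff_coulombImpliesNontrivial_and_gaussianLimitIsCoulomb.2 ⟨h3, h⟩
  · intro h
    rw [gaussianLimitIsCoulomb_iff_not_coulomb_imp_r4NonGaussian]
    exact fun hC => h fun hC' => absurd hC' hC

/-- **r3 ↔ (item 1343 ⇒ 0636)**, the mirror image: the Coulomb crux says exactly that the support item
`GaussianLimitIsCoulomb` would already give `IsingEuclidUpgradeR4NonGaussian`. [folklore] -/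
theorem coulombImpliesNontrivial_iff_gaussianLimitIsCoulomb_imp_r4NonGaussian :
    PerfectScreening.CoulombImpliesNontrivial ↔
      (PerfectScreening.GaussianLimitIsCoulomb → IsingEuclidUpgrade.IsingEuclidUpgradeR4NonGaussian) := by
  constructor
  · exact fun h3 h =>
      r4NonGaussian_iff_coulombImpliesNontrivial_and_gaussianLimitIsCoulomb.2 ⟨h3, h⟩
  · intro h hC
    exact h (gaussianLimitIsCoulomb_iff_not_coulomb_imp_r4NonGaussian.2 fun hC' => absurd hC hC')

/-- **`1343 ∨ r3` outright**: by excluded middle on the Coulomb lower bound, at least one of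
`GaussianLimitIsCoulomb` (true if `Coulomb` holds) and `CoulombImpliesNontrivial` (true if it fails)
holds; in particular a refutation of either item is a PROOF of the other. [folklore] -/
theorem gaussianLimitIsCoulomb_or_coulombImpliesNontrivial :
    PerfectScreening.GaussianLimitIsCoulomb ∨ PerfectScreening.CoulombImpliesNontrivial := by
  by_cases hC : ∃ c : ℝ, 0 < c ∧ ∀ x : Site 3, x ≠ 0 → c / ‖x‖ ≤ criticalTwoPoint 3 x
  · exact Or.inl fun _ _ _ _ _ _ _ _ => hC
  · exact Or.inr fun hC' => absurd hC' hC

end Summit.CriticalPhenomena.Ising3DConformalLimit.PerfectScreeningGaussianLimitIsCoulomb
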